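import Mathlib
import HarnessLib
import Summits.HubbardSuperconductivity.HubbardSuperconductivity.Theorems.KLProgrammeKLRegimeTwoVolumeLipDoubledTruncDefs
import Summits.HubbardSuperconductivity.HubbardSuperconductivity.Theorems.KLProgrammeKLRegimeTwoVolumeLipDoubledIdentity

/-!
# Route `KLProgramme` — crux K3 ENGINE (stmt-HubbardSuperconductivity-20437), stub (e) proof-input «(e)-D-ROWS», keying (A′), REKEY-D file DT1:
# THE TRUNCATED DOUBLED TOWER FLOWS BY ITSELF — block identity and LIP/SRC split of the source-truncated objects
# (seat hubbard-kl-k3c4-p1 g28; truncated twin of ✓ D1 `…TwoVolumeLipDoubledIdentity` and ✓ D4a `…TwoVolumeLipDoubledBornDiffParts`; `--supports` 23356)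

The spectator covariance `klLipCovD = C ⊕ 0` vanishes on the plain copy and the doubled transfer `klLipTransferD = T ⊕ shift` sends plain legs to plain legs, so
`Lit/GrassmannSourceGrading` applies (BGM 2006 §2.9: the part of source degree `< 3` flows by itself):

* §1 `klLipCovD_eq_zero_of_plain` (the `hC` of `srcTrunc_effAction_srcTrunc`), `toMatrix'_klLipTransferD_eq_zero_of_plain` (the `hf` of `srcTrunc_map_srcTrunc`);
* §2 **`klLipBornDT_eq_srcTrunc_map_step`** — `klLipBornDT = srcTrunc 3 (map (toLin' T⁺) (effAction (C ⊕ 0) klLipInputDT − klLipInputDT))`: the truncated born increment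
  is the truncation of the spectator-step born term OF THE TRUNCATED INPUT (✓ D1 `klLipBornD_eq_map_step` + `srcTrunc_map_effAction_srcTrunc` + `srcTrunc_map_srcTrunc`);
* §3 **`klLipBornDiffDT_eq_srcTrunc_lip_add_src`** — at the common frame the truncated born difference is the truncation of `LIP + SRC` built on the truncated coarse
  input `I_T := klLipInputDT L` and the truncated difference `D_T := klLipInputDiffDT` (`V := klGlueD I_T`, `V + D_T = klLipInputDT (bL)`):
  `LIP = map T⁺(born⁺(V + D_T) − (V + D_T)) − map T⁺(born⁺ V − V)`, `SRC = map T⁺_{bL}(born⁺ V − V) − klGlueD (map T⁺_L (born⁺_L I_T − I_T))`;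
* §4 **`sum_pinned_norm_kernel_klLipBornDiffDT_le_of_parts`** — hence at ANY pin the pinned kernel sum of `klLipBornDiffDT` is at most a bound of the pinned sum of
  `LIP` plus a bound of that of `SRC` (truncation only drops kernels: `kernel_srcTrunc`; triangle).

Identities and one triangle inequality; nothing about the model is asserted beyond ✓ D1; nothing asserts the (D) rows, (e), VL, K3 or superconductivity.
References: BGM 2006 §2.7 (2.70)–(2.71), §2.9 (4.3)–(4.6) [cite: BenfattoGiulianiMastropietro2006]; Salmhofer 1999 §4.3 (4.95).
-/

noncomputable section

namespace Summit.HubbardSuperconductivity.HubbardSuperconductivity.Theorems.TwoVolumeLip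

set_option linter.dupNamespace false -- summit = problem name (single-conjunct summit), D-0017

open Finset Literature.MathematicalPhysics.QuantumLattice GrassmannAlgebra Literature.Probability.LatticeModels
open Literature.MathematicalPhysics.QuantumLattice.FermiRG
open Summit.HubbardSuperconductivity.HubbardSuperconductivity.Theorems.KLRegimeSplit
open Summit.HubbardSuperconductivity.HubbardSuperconductivity.Theorems.KLProgrammeLegKernels
open Summit.HubbardSuperconductivity.HubbardSuperconductivity.Theorems.EngineV8
open Summit.HubbardSuperconductivity.HubbardSuperconductivity.Theorems.TwoVolumeSource
open Summit.HubbardSuperconductivity.HubbardSuperconductivity.Theorems.TwoVolumeDefect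

/-! ## DT1 §1 The spectator covariance and the doubled transfer respect the source predicate -/

section SourceCompat

variable {V M : ℕ} [NeZero V]

/-- **The spectator covariance vanishes on the plain copy** (the `hC` of `Lit/GrassmannSourceGrading`). -/
theorem klLipCovD_eq_zero_of_plain (β μ : ℝ) (K : TrigPolyC4v) (d k : ℕ) (X Y : SrcLabel V M (d * k - 1))
    (h : X.2 = 1 ∨ Y.2 = 1) : klLipCovD V M β μ K d k X Y = 0 := by
  rw [klLipCovD_apply, if_neg]
  rintro ⟨hX, hY⟩
  rcases h with h | h
  · rw [h] at hX; exact absurd hX (by decide)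
  · rw [h] at hY; exact absurd hY (by decide)

/-- **The doubled transfer sends plain legs to plain legs only** (the `hf` of `Lit/GrassmannSourceGrading.srcTrunc_map_srcTrunc`): its matrix entry from a plain column
to a non-plain row vanishes. -/
theorem toMatrix'_klLipTransferD_eq_zero_of_plain (β μ : ℝ) (K : TrigPolyC4v) (d k : ℕ) (X : SrcLabel V M (d * k - 1)) (X' : SrcLabel V M (d * k))
    (hX : X.2 = 1) (hX' : ¬ X'.2 = 1) : LinearMap.toMatrix' (Matrix.toLin' (klLipTransferD V M β μ K d k)) X' X = 0 := by
  rw [LinearMap.toMatrix'_toLin', klLipTransferD_apply, if_neg, if_neg]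
  · rintro ⟨h', -⟩; exact hX' h'
  · rintro ⟨-, h⟩; rw [hX] at h; exact absurd h (by decide)

end SourceCompat

/-! ## DT1 §2 One volume: the truncated block identity -/

section OneVolumeT

variable {V M : ℕ} [NeZero V] [NeZero M]

/-- **THE TRUNCATED BLOCK IDENTITY** (`β ≠ 0`, `1 ≤ dk`, `Z^K_{Λ_{dk}} ≠ 0`):
`klLipBornDT … d k = srcTrunc 3 (map (toLin' klLipTransferD) (effAction klLipCovD (klLipInputDT … d k) − klLipInputDT … d k))` — the truncated born increment is the
truncation of ONE substitution of the spectator-step born term of the TRUNCATED input (BGM 2006 §2.9: the terms with ≥ 3 external legs never feed back).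
[cite: BenfattoGiulianiMastropietro2006, §2.9 (4.3)-(4.6)] -/
theorem klLipBornDT_eq_srcTrunc_map_step {β : ℝ} (hβ : β ≠ 0) (U μ : ℝ) (K : TrigPolyC4v) {d k : ℕ} (hdk : 1 ≤ d * k)
    (hZ : hubbardEffPartitionFnCT V M β U μ 0 K (klScale klE0 (d * k)) ≠ 0) :
    klLipBornDT V M β U μ K d k =
      srcTrunc ℂ (fun Y : SrcLabel V M (d * k) => Y.2 = 1) 3
        (ExteriorAlgebra.map (Matrix.toLin' (klLipTransferD V M β μ K d k))
          (effAction ℂ (klLipCovD V M β μ K d k) (klLipInputDT V M β U μ K d k) - klLipInputDT V M β U μ K d k)) := by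
  have hI0 : constPart ℂ (klLipInputD V M β U μ K d k) = 0 := by
    rw [constPart_klLipInputD]; exact constPart_klEffectiveAction_eq_zero β U μ K klE0 (d * k) hZ
  rw [klLipBornDT_def, klLipBornD_eq_map_step hβ U μ K hdk hZ, map_sub, map_sub, srcTrunc_sub, srcTrunc_sub, klLipInputDT_def,
    srcTrunc_map_effAction_srcTrunc (R := ℂ) (P := fun Y : SrcLabel V M (d * k - 1) => Y.2 = 1) (C := klLipCovD V M β μ K d k)
      (P' := fun Y : SrcLabel V M (d * k) => Y.2 = 1) (klLipCovD_eq_zero_of_plain β μ K d k) _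
      (toMatrix'_klLipTransferD_eq_zero_of_plain β μ K d k) 3 hI0,
    srcTrunc_map_srcTrunc (R := ℂ) (P := fun Y : SrcLabel V M (d * k - 1) => Y.2 = 1) (P' := fun Y : SrcLabel V M (d * k) => Y.2 = 1) _
      (toMatrix'_klLipTransferD_eq_zero_of_plain β μ K d k) 3]

end OneVolumeT

/-! ## DT1 §3 Two volumes at the common frame: the truncated born difference = truncation of (LIP + SRC) on the truncated inputs -/

section TwoVolumesT

variable {L b M : ℕ} [NeZero L] [NeZero (b * L)] [NeZero M]

/-- **THE TRUNCATED BORN DIFFERENCE IS THE TRUNCATION OF LIP + SRC BUILT ON THE TRUNCATED INPUTS** (common frame `K`, block `k`, `1 ≤ dk`, both partition functions `≠ 0`;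
`born⁺_V Y := effAction klLipCovD^{V} Y − Y`, `I_T := klLipInputDT L`, `V := klGlueD I_T`, `D_T := klLipInputDiffDT`, `V + D_T = klLipInputDT (bL)`):
`klLipBornDiffDT = srcTrunc 3 ([map T⁺(born⁺(V + D_T)) − map T⁺(born⁺ V)] + [map T⁺(born⁺ V) − klGlueD (map T⁺_L (born⁺_L I_T))])`.
[cite: BenfattoGiulianiMastropietro2006, §2.7 (2.70)-(2.71), §2.9 (4.3)-(4.6)] -/
theorem klLipBornDiffDT_eq_srcTrunc_lip_add_src {β : ℝ} (hβ : β ≠ 0) (U μ : ℝ) (K : TrigPolyC4v) {d k : ℕ} (hdk : 1 ≤ d * k)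
    (hZf : hubbardEffPartitionFnCT (b * L) M β U μ 0 K (klScale klE0 (d * k)) ≠ 0)
    (hZc : hubbardEffPartitionFnCT L M β U μ 0 K (klScale klE0 (d * k)) ≠ 0) :
    klLipBornDiffDT L b M β U μ K d k =
      srcTrunc ℂ (fun Y : SrcLabel (b * L) M (d * k) => Y.2 = 1) 3
        ((ExteriorAlgebra.map (Matrix.toLin' (klLipTransferD (b * L) M β μ K d k))
            (effAction ℂ (klLipCovD (b * L) M β μ K d k)
                (klGlueD L b M (d * k - 1) (klLipInputDT L M β U μ K d k) + klLipInputDiffDT L b M β U μ K d k) -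
              (klGlueD L b M (d * k - 1) (klLipInputDT L M β U μ K d k) + klLipInputDiffDT L b M β U μ K d k)) -
          ExteriorAlgebra.map (Matrix.toLin' (klLipTransferD (b * L) M β μ K d k))
            (effAction ℂ (klLipCovD (b * L) M β μ K d k) (klGlueD L b M (d * k - 1) (klLipInputDT L M β U μ K d k)) -
              klGlueD L b M (d * k - 1) (klLipInputDT L M β U μ K d k))) +
        (ExteriorAlgebra.map (Matrix.toLin' (klLipTransferD (b * L) M β μ K d k))
            (effAction ℂ (klLipCovD (b * L) M β μ K d k) (klGlueD L b M (d * k - 1) (klLipInputDT L M β U μ K d k)) -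
              klGlueD L b M (d * k - 1) (klLipInputDT L M β U μ K d k)) -
          klGlueD L b M (d * k)
            (ExteriorAlgebra.map (Matrix.toLin' (klLipTransferD L M β μ K d k))
              (effAction ℂ (klLipCovD L M β μ K d k) (klLipInputDT L M β U μ K d k) - klLipInputDT L M β U μ K d k)))) := by
  rw [klLipBornDiffDT_def, klLipBornDT_eq_srcTrunc_map_step (V := b * L) hβ U μ K hdk hZf, klLipBornDT_eq_srcTrunc_map_step (V := L) hβ U μ K hdk hZc,
    klGlueD_srcTrunc, ← srcTrunc_sub, klLipInputDT_fine_eq (L := L) (b := b) β U μ K d k]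
  congr 1
  abel

/-- **The truncated born difference of block `k` as LIP + SRC at any pin**: a bound `B₁` of the pinned sum of the Lipschitz part (the left side of the deep block-step door at
`V := klGlueD (klLipInputDT L)`, `D := klLipInputDiffDT`) plus a bound `B₂` of the pinned sum of the source in transfer form (the left side of the source transfer door at the
truncated coarse input) bound the pinned kernel sum of `klLipBornDiffDT … d k` (the truncation only drops kernels; triangle). [cite: BenfattoGiulianiMastropietro2006, §2.7 (2.70)-(2.71)] -/
theorem sum_pinned_norm_kernel_klLipBornDiffDT_le_of_parts {β : ℝ} (hβ : β ≠ 0) (U μ : ℝ) (K : TrigPolyC4v) {d k : ℕ} (hdk : 1 ≤ d * k)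
    (hZf : hubbardEffPartitionFnCT (b * L) M β U μ 0 K (klScale klE0 (d * k)) ≠ 0)
    (hZc : hubbardEffPartitionFnCT L M β U μ 0 K (klScale klE0 (d * k)) ≠ 0)
    {m : ℕ} (i : Fin m) (w'' : SrcLabel (b * L) M (d * k)) {B₁ B₂ : ℝ}
    (h₁ : ∑ X'' ∈ univ.filter (fun X'' : Fin m → SrcLabel (b * L) M (d * k) => X'' i = w''),
      ‖kernel ℂ (ExteriorAlgebra.map (Matrix.toLin' (klLipTransferD (b * L) M β μ K d k))
          ((effAction ℂ (klLipCovD (b * L) M β μ K d k)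
                (klGlueD L b M (d * k - 1) (klLipInputDT L M β U μ K d k) + klLipInputDiffDT L b M β U μ K d k) -
              (klGlueD L b M (d * k - 1) (klLipInputDT L M β U μ K d k) + klLipInputDiffDT L b M β U μ K d k)) -
            (effAction ℂ (klLipCovD (b * L) M β μ K d k) (klGlueD L b M (d * k - 1) (klLipInputDT L M β U μ K d k)) -
              klGlueD L b M (d * k - 1) (klLipInputDT L M β U μ K d k)))) m X''‖ ≤ B₁)
    (h₂ : ∑ X'' ∈ univ.filter (fun X'' : Fin m → SrcLabel (b * L) M (d * k) => X'' i = w''),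
      ‖kernel ℂ (ExteriorAlgebra.map (Matrix.toLin' (klLipTransferD (b * L) M β μ K d k))
              (effAction ℂ (klLipCovD (b * L) M β μ K d k) (klGlueD L b M (d * k - 1) (klLipInputDT L M β U μ K d k)) -
                klGlueD L b M (d * k - 1) (klLipInputDT L M β U μ K d k)) -
          klGlueD L b M (d * k)
            (ExteriorAlgebra.map (Matrix.toLin' (klLipTransferD L M β μ K d k))
              (effAction ℂ (klLipCovD L M β μ K d k) (klLipInputDT L M β U μ K d k) - klLipInputDT L M β U μ K d k))) m X''‖ ≤ B₂) :
    ∑ X'' ∈ univ.filter (fun X'' : Fin m → SrcLabel (b * L) M (d * k) => X'' i = w''),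
        ‖kernel ℂ (klLipBornDiffDT L b M β U μ K d k) m X''‖ ≤ B₁ + B₂ := by
  classical
  rw [klLipBornDiffDT_eq_srcTrunc_lip_add_src hβ U μ K hdk hZf hZc]
  -- abbreviate the two parts
  set A := ExteriorAlgebra.map (Matrix.toLin' (klLipTransferD (b * L) M β μ K d k))
      (effAction ℂ (klLipCovD (b * L) M β μ K d k)
          (klGlueD L b M (d * k - 1) (klLipInputDT L M β U μ K d k) + klLipInputDiffDT L b M β U μ K d k) -
        (klGlueD L b M (d * k - 1) (klLipInputDT L M β U μ K d k) + klLipInputDiffDT L b M β U μ K d k)) -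
    ExteriorAlgebra.map (Matrix.toLin' (klLipTransferD (b * L) M β μ K d k))
      (effAction ℂ (klLipCovD (b * L) M β μ K d k) (klGlueD L b M (d * k - 1) (klLipInputDT L M β U μ K d k)) -
        klGlueD L b M (d * k - 1) (klLipInputDT L M β U μ K d k)) with hA
  set B := ExteriorAlgebra.map (Matrix.toLin' (klLipTransferD (b * L) M β μ K d k))
        (effAction ℂ (klLipCovD (b * L) M β μ K d k) (klGlueD L b M (d * k - 1) (klLipInputDT L M β U μ K d k)) -
          klGlueD L b M (d * k - 1) (klLipInputDT L M β U μ K d k)) -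
      klGlueD L b M (d * k)
        (ExteriorAlgebra.map (Matrix.toLin' (klLipTransferD L M β μ K d k))
          (effAction ℂ (klLipCovD L M β μ K d k) (klLipInputDT L M β U μ K d k) - klLipInputDT L M β U μ K d k)) with hB
  have h₁' : ∑ X'' ∈ univ.filter (fun X'' : Fin m → SrcLabel (b * L) M (d * k) => X'' i = w''), ‖kernel ℂ A m X''‖ ≤ B₁ := by
    refine le_of_eq_of_le (sum_congr rfl fun X'' _ => ?_) h₁
    rw [hA, ← map_sub]
  have hsplit : ∀ X'' : Fin m → SrcLabel (b * L) M (d * k),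
      ‖kernel ℂ (srcTrunc ℂ (fun Y : SrcLabel (b * L) M (d * k) => Y.2 = 1) 3 (A + B)) m X''‖ ≤ ‖kernel ℂ A m X''‖ + ‖kernel ℂ B m X''‖ := by
    intro X''
    rw [kernel_srcTrunc]
    split_ifs
    · rw [kernel_add]; exact norm_add_le _ _
    · rw [norm_zero]; positivity
  refine le_trans (Finset.sum_le_sum fun X'' _ => hsplit X'') ?_
  rw [Finset.sum_add_distrib]
  exact add_le_add h₁' h₂

end TwoVolumesT

end Summit.HubbardSuperconductivity.HubbardSuperconductivity.Theorems.TwoVolumeLip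

end
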